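import Mathlib
import Summits.Parity.GeneralizedHardyLittlewood.Theses.LiouvilleShiftedTables

/-!
# Sketch — crux-ideate stmt-Parity-14270 (TableChowla), ideator 2, round 1

First lemmas of the idea cards (statements only; they must elaborate, proofs are not required here).
-/

namespace Summit.Parity.GeneralizedHardyLittlewood.Cruxes.TableChowla.HelsonKroneckerInverse

open Summit.Parity.GeneralizedHardyLittlewood.Theses.LiouvilleShiftedTables

/-- The shifted multiplication table entry `λ(ab+c)` as a real number (the crux's summand). -/
noncomputable def entry (c : ℤ) (a b : ℕ) : ℝ :=
  (ArithmeticFunction.liouville (Int.toNat ((a : ℤ) * b + c)) : ℝ)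

/-- FIRST LEMMA (necessity direction of the CM-test-vector reduction; provable now, elementary:
two Cauchy–Schwarz steps, no spectral theory). The `(λ,λ)` test vector: TableChowla forces the
`r_A`-weighted binary Chowla sum `Σ_{a∼A} Σ_{b≤x/A} λ(ab)·λ(ab+c)` to have EVERY log-power saving,
uniformly in the window. -/
def HyperbolicTernary : Prop :=
  ∀ c : ℤ, c ≠ 0 → ∀ δ : ℝ, 0 < δ → δ ≤ 1 / 12 → ∀ C : ℝ, 0 < C → ∃ x₀ : ℝ, ∀ x : ℝ, x₀ ≤ x →
    ∀ A : ℝ, x ^ δ ≤ A → A ≤ x ^ (1 / 3 + δ) →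
      |∑ a ∈ Finset.Ioc ⌊A⌋₊ ⌊2 * A⌋₊, ∑ b ∈ Finset.Icc 1 ⌊x / A⌋₊,
        (ArithmeticFunction.liouville (a * b) : ℝ) * entry c a b| ≤ x / Real.log x ^ C

theorem first_lemma : TableChowla → HyperbolicTernary := by
  sorry

/-- The general necessity statement: every pair of completely multiplicative 1-bounded test
vectors `(f,g)` sees the full log-power saving (contains `HyperbolicTernary` at `f = g = λ`, the
Bombieri–Vinogradov-type 1-point statements at `f, g` Dirichlet characters, and twisted versions). -/
def CMTestVectorBound : Prop :=
  ∀ c : ℤ, c ≠ 0 → ∀ δ : ℝ, 0 < δ → δ ≤ 1 / 12 → ∀ C : ℝ, 0 < C → ∃ x₀ : ℝ, ∀ x : ℝ, x₀ ≤ x →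
    ∀ A : ℝ, x ^ δ ≤ A → A ≤ x ^ (1 / 3 + δ) →
    ∀ f g : ℕ → ℂ, (∀ m n, f (m * n) = f m * f n) → (∀ n, ‖f n‖ ≤ 1) →
      (∀ m n, g (m * n) = g m * g n) → (∀ n, ‖g n‖ ≤ 1) →
      ‖∑ a ∈ Finset.Ioc ⌊A⌋₊ ⌊2 * A⌋₊, ∑ b ∈ Finset.Icc 1 ⌊x / A⌋₊,
        f a * g b * (entry c a b : ℂ)‖ ≤ x / Real.log x ^ C

theorem cm_necessary : TableChowla → CMTestVectorBound := by
  sorry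

/-- K1 (the new lever, INVERSE THEOREM for finite Helson sections of `λ(·+c)`): if some pair of
`ℓ²`-unit test vectors makes the bilinear form `Σ u_a v_b λ(ab+c)` as large as `√x/(log x)^C`
(i.e. the table has a singular value a log-power below trivial), then some pair of completely
multiplicative 1-bounded test vectors does too, with a polylog loss `C ↦ C'`. -/
def InverseMH : Prop :=
  ∀ c : ℤ, c ≠ 0 → ∀ δ : ℝ, 0 < δ → δ ≤ 1 / 12 → ∀ C' : ℝ, 0 < C' → ∃ C x₀ : ℝ, 0 < C ∧
    ∀ x : ℝ, x₀ ≤ x → ∀ A : ℝ, x ^ δ ≤ A → A ≤ x ^ (1 / 3 + δ) →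
    ∀ u v : ℕ → ℝ, (∑ a ∈ Finset.Ioc ⌊A⌋₊ ⌊2 * A⌋₊, u a ^ 2 ≤ 1) →
      (∑ b ∈ Finset.Icc 1 ⌊x / A⌋₊, v b ^ 2 ≤ 1) →
      x ^ (1 / 2 : ℝ) / Real.log x ^ C ≤
        |∑ a ∈ Finset.Ioc ⌊A⌋₊ ⌊2 * A⌋₊, ∑ b ∈ Finset.Icc 1 ⌊x / A⌋₊, u a * v b * entry c a b| →
      ∃ f g : ℕ → ℂ, (∀ m n, f (m * n) = f m * f n) ∧ (∀ n, ‖f n‖ ≤ 1) ∧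
        (∀ m n, g (m * n) = g m * g n) ∧ (∀ n, ‖g n‖ ≤ 1) ∧
        x / Real.log x ^ C' ≤ ‖∑ a ∈ Finset.Ioc ⌊A⌋₊ ⌊2 * A⌋₊, ∑ b ∈ Finset.Icc 1 ⌊x / A⌋₊,
          f a * g b * (entry c a b : ℂ)‖

/-- Operator-norm form of the crux (FACT 1: equivalent to TableChowla up to `C ↦ 4C`, by
`σ₁⁴ ≤ tr(MMᵀ)² ≤ σ₁²·#entries`). -/
def OperatorNormForm : Prop :=
  ∀ c : ℤ, c ≠ 0 → ∀ δ : ℝ, 0 < δ → δ ≤ 1 / 12 → ∀ C : ℝ, 0 < C → ∃ x₀ : ℝ, ∀ x : ℝ, x₀ ≤ x →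
    ∀ A : ℝ, x ^ δ ≤ A → A ≤ x ^ (1 / 3 + δ) →
    ∀ u v : ℕ → ℝ, (∑ a ∈ Finset.Ioc ⌊A⌋₊ ⌊2 * A⌋₊, u a ^ 2 ≤ 1) →
      (∑ b ∈ Finset.Icc 1 ⌊x / A⌋₊, v b ^ 2 ≤ 1) →
      |∑ a ∈ Finset.Ioc ⌊A⌋₊ ⌊2 * A⌋₊, ∑ b ∈ Finset.Icc 1 ⌊x / A⌋₊, u a * v b * entry c a b| ≤
        x ^ (1 / 2 : ℝ) / Real.log x ^ C

/-- Linear algebra (provable now): the operator-norm form implies the crux. -/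
theorem tableChowla_of_operatorNormForm : OperatorNormForm → TableChowla := by
  sorry

/-- The line: inverse theorem + CM-test-vector bound ⟹ operator-norm form (pure logic up to the
quantifier bookkeeping `C ↦ C'`). -/
theorem operatorNormForm_of_inverse : InverseMH → CMTestVectorBound → OperatorNormForm := by
  sorry

end Summit.Parity.GeneralizedHardyLittlewood.Cruxes.TableChowla.HelsonKroneckerInverse
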